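import Mathlib.Analysis.SpecialFunctions.Pow.Real
import Mathlib.Analysis.SpecialFunctions.Log.Basic
import Mathlib.Analysis.SpecialFunctions.Pow.Asymptotics
import Mathlib.Data.Nat.Log
import HarnessLib

/-!
# Crux `LatticeGapOnTrajectory` (stmt-QuantumFields-10523): elementary helpers for the symmetric
# transfer (`stub_transferSym`, line `orbit-kantorovich-finite-size`, reshape 4; lead c2)

Helper file (`--supports stmt-QuantumFields-10523`). Pure arithmetic / real analysis used by the
Hankel route to the transfer clause:

* `pow_log_window` — the dyadic depth `J = log₂ ⌊(L − 2w)/m⌋` of the Hankel chain on a torus of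
  half-side `L` for an observable of width `w` at separation `m`: all dyadic separations fit
  (`2^J m + 2w ≤ L`) and `J` is maximal up to a factor two (`(L − 2w)/m < 2·2^J + 1`);
* `tendsto_log_div_of_growth` — if `log C_k ≤ A + p (ℓ_k + log u_k)` with `u_k → ∞`,
  `ℓ_k / u_k → 0` (physical volume `u_k = a_k L_k` outgrowing `ℓ_k = log(1/a_k)`) and
  `N_k ≥ c u_k`, then `log C_k / N_k → 0` — the loss factor `C_k^{1/N_k}` of the Hankel chain tends
  to one;
* `rpow_prefactor_mono` — monotonicity of the diagonal bound `(v^{N−1} (κ (b² + 1)))^{1/N}` in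
  `v, b ≥ 0`.

References: Fröhlich–Israel–Lieb–Simon 1978 §2 (log-convexity); Glimm–Jaffe 1987 §19.7.
-/

open Filter Topology

noncomputable section

namespace Summit.QuantumFields.YangMills.Cruxes.LatticeGapOnTrajectory.OrbitKantorovichFiniteSize

namespace Transfer

namespace SymHelpers

/-- **Dyadic depth of the Hankel chain.** For `0 < m` and `m + 2w ≤ L` put
`J = Nat.log 2 ((L − 2w)/m)`; then `2^J m + 2w ≤ L` and `(L − 2w)/m < 2·2^J + 1` (real quotient).
[folklore] -/
theorem pow_log_window {L w m : ℕ} (hm : 0 < m) (hL : m + 2 * w ≤ L) :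
    2 ^ Nat.log 2 ((L - 2 * w) / m) * m + 2 * w ≤ L ∧
      ((L : ℝ) - 2 * w) / m < 2 * (2 : ℝ) ^ Nat.log 2 ((L - 2 * w) / m) + 1 := by
  set Q := (L - 2 * w) / m with hQ
  have hQ1 : 1 ≤ Q := (Nat.le_div_iff_mul_le hm).2 (by omega)
  have hpow : 2 ^ Nat.log 2 Q ≤ Q := Nat.pow_log_le_self 2 (by omega)
  refine ⟨?_, ?_⟩
  · have h1 : 2 ^ Nat.log 2 Q * m ≤ Q * m := Nat.mul_le_mul_right _ hpow
    have h2 : Q * m ≤ L - 2 * w := Nat.div_mul_le_self _ _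
    omega
  · have hlt : Q < 2 ^ (Nat.log 2 Q).succ := Nat.lt_pow_succ_log_self (by norm_num) Q
    have hmod : L - 2 * w = m * Q + (L - 2 * w) % m := (Nat.div_add_mod _ _).symm
    have hr : (L - 2 * w) % m < m := Nat.mod_lt _ hm
    have hmR : (0 : ℝ) < m := by exact_mod_cast hm
    have hsub : ((L : ℝ) - 2 * w) = ((L - 2 * w : ℕ) : ℝ) := by
      rw [Nat.cast_sub (by omega)]; push_cast; ring
    rw [hsub, div_lt_iff₀ hmR, hmod]
    have hQ' : (Q : ℝ) + 1 ≤ 2 * (2 : ℝ) ^ Nat.log 2 Q := by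
      have : Q + 1 ≤ 2 ^ (Nat.log 2 Q).succ := hlt
      rw [pow_succ] at this
      exact_mod_cast (by linarith [this] : (Q : ℕ) + 1 ≤ 2 * 2 ^ Nat.log 2 Q)
    push_cast
    have hrR : (((L - 2 * w) % m : ℕ) : ℝ) < m := by exact_mod_cast hr
    nlinarith [hQ', hrR, hmR]

/-- **The loss factor tends to one.** If `0 ≤ log C_k ≤ A + p (ℓ_k + log u_k)` eventually, with
`u_k → ∞`, `ℓ_k ≥ 0`, `ℓ_k / u_k → 0`, and `N_k ≥ c u_k` eventually (`c > 0`), then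
`log C_k / N_k → 0`. [folklore] -/
theorem tendsto_log_div_of_growth {u ℓ C : ℕ → ℝ} {Nn : ℕ → ℕ} {A p c : ℝ} (hc : 0 < c)
    (hu : Tendsto u atTop atTop) (hℓ0 : ∀ᶠ k in atTop, 0 ≤ ℓ k)
    (hℓ : Tendsto (fun k => ℓ k / u k) atTop (𝓝 0))
    (hC1 : ∀ᶠ k in atTop, 1 ≤ C k)
    (hCle : ∀ᶠ k in atTop, Real.log (C k) ≤ A + p * (ℓ k + Real.log (u k)))
    (hN : ∀ᶠ k in atTop, c * u k ≤ Nn k) :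
    Tendsto (fun k => Real.log (C k) / Nn k) atTop (𝓝 0) := by
  -- the dominating sequence
  have hlog : Tendsto (fun k => Real.log (u k) / u k) atTop (𝓝 0) :=
    (Real.isLittleO_log_id_atTop.comp_tendsto hu).tendsto_div_nhds_zero
  have hinv : Tendsto (fun k => (u k)⁻¹) atTop (𝓝 0) := tendsto_inv_atTop_zero.comp hu
  have hdom : Tendsto (fun k => |A| / c * (u k)⁻¹ + p / c * (ℓ k / u k) + p / c * (Real.log (u k) / u k))
      atTop (𝓝 0) := by
    simpa using ((hinv.const_mul (|A| / c)).add (hℓ.const_mul (p / c))).add (hlog.const_mul (p / c))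
  refine squeeze_zero' ?_ ?_ hdom
  · filter_upwards [hC1] with k hk
    exact div_nonneg (Real.log_nonneg hk) (Nat.cast_nonneg _)
  · filter_upwards [hC1, hCle, hN, hℓ0, hu.eventually_ge_atTop 1] with k hk1 hk2 hk3 hk4 hk5
    have hu0 : 0 < u k := by linarith
    have hNpos : 0 < (Nn k : ℝ) := lt_of_lt_of_le (by positivity) hk3
    have hlogu : 0 ≤ Real.log (u k) := Real.log_nonneg hk5
    calc Real.log (C k) / Nn k ≤ Real.log (C k) / (c * u k) :=
          div_le_div_of_nonneg_left (Real.log_nonneg hk1) (mul_pos hc hu0) hk3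
      _ ≤ (|A| + p * (ℓ k + Real.log (u k))) / (c * u k) := by
          gcongr
          exact hk2.trans (by linarith [le_abs_self A])
      _ = |A| / c * (u k)⁻¹ + p / c * (ℓ k / u k) + p / c * (Real.log (u k) / u k) := by
          field_simp
          ring

/-- **Monotonicity of the diagonal bound**: `(v^{N−1} (κ (b² + 1)))^{1/N}` is monotone in
`v ≥ 0` and `b ≥ 0` for `κ ≥ 0`, `N ≥ 1`. [folklore] -/
theorem rpow_prefactor_mono {κ : ℝ} (hκ : 0 ≤ κ) (Nn : ℕ) {v v' b b' : ℝ} (hv : 0 ≤ v) (hvv : v ≤ v')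
    (hb : 0 ≤ b) (hbb : b ≤ b') :
    (v ^ (Nn - 1) * (κ * (b ^ 2 + 1))) ^ ((Nn : ℝ)⁻¹) ≤
      (v' ^ (Nn - 1) * (κ * (b' ^ 2 + 1))) ^ ((Nn : ℝ)⁻¹) := by
  refine Real.rpow_le_rpow (by positivity) ?_ (by positivity)
  have h1 : v ^ (Nn - 1) ≤ v' ^ (Nn - 1) := pow_le_pow_left₀ hv hvv _
  have h2 : b ^ 2 + 1 ≤ b' ^ 2 + 1 := by nlinarith
  exact mul_le_mul h1 (mul_le_mul_of_nonneg_left h2 hκ) (by positivity) (pow_nonneg (hv.trans hvv) _)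

end SymHelpers

end Transfer

end Summit.QuantumFields.YangMills.Cruxes.LatticeGapOnTrajectory.OrbitKantorovichFiniteSize

end
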